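import Mathlib.Analysis.InnerProductSpace.PiL2
import Mathlib.Topology.MetricSpace.Pseudo.Defs
import HarnessLib

/-!
# The distance to a far point is almost linear in Gromov–Hausdorff coordinates

The elementary estimate with which Colding's volume convergence and the Cheeger–Colding theory
turn Gromov–Hausdorff closeness to `ℝⁿ` into almost-splitting / almost-coordinate functions
(Colding, Ann. of Math. 145 (1997) 477–501, §1–§2; Cheeger–Colding 1997, proof of Thm. A.1.5;
Cheeger, *Degeneration of Riemannian metrics under Ricci curvature bounds*, §9): the Euclidean
law of cosines

* `abs_norm_sub_smul_sub_add_inner_le` — for a unit vector `e`, `R > 0` and `‖v‖ ≤ r ≤ R/2`: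
  `|‖v − R e‖ − R + ⟪v, e⟫| ≤ 2 r²/R`,

and its transfer through an `ε`-Gromov–Hausdorff chart `f` (an `ε`-isometry on a set `S` of a
pseudometric space):

* `abs_dist_sub_add_inner_le_of_ghChart` — if `q ∈ S` is charted near the far point,
  `‖f q − R e‖ ≤ ε`, then for `x ∈ S` with `‖f x‖ ≤ r ≤ R/2`:
  `|d(q, x) − R + ⟪f x, e⟫| ≤ 2ε + 2r²/R`,
* `abs_dist_sub_dist_add_inner_le_of_ghChart` — the normalised "Busemann-type" function
  `b(x) = d(q, x) − d(q, p)` of a base point `p ∈ S` with `‖f p‖ ≤ r` satisfies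
  `|b(x) + ⟪f x − f p, e⟫| ≤ 4ε + 4r²/R`: up to these errors, `b` is the linear function
  `−⟪·, e⟫` in the chart.

No definitions, no named facts (D-0026). Groundwork for `CheegerColding1997_sphereStability`
(blocks (II)/(III): almost splitting functions from GH-closeness).

## References

* T. H. Colding, *Ricci curvature and volume convergence*, Ann. of Math. 145 (1997) 477–501, §1.
* J. Cheeger, T. H. Colding, J. Differential Geom. 46 (1997) 406–480, App. 1. [CheegerColding1997]
-/

noncomputable section

open Set Metric
open scoped RealInnerProductSpace

namespace Literature.Geometry.Euclidean

variable {E : Type*} [NormedAddCommGroup E] [InnerProductSpace ℝ E]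

/-- **Law of cosines, far point**: for a unit vector `e`, `R > 0` and `‖v‖ ≤ r ≤ R/2`,
`|‖v − R e‖ − R + ⟪v, e⟫| ≤ 2r²/R`. Proof: with `D = ‖v − Re‖`,
`D − R + ⟪v,e⟫ = (‖v‖² + ⟪v,e⟫ (D − R))/(D + R)`, `|D − R| ≤ ‖v‖`, `D + R ≥ 3R/2`. [folklore] -/
theorem abs_norm_sub_smul_sub_add_inner_le {e v : E} (he : ‖e‖ = 1) {R r : ℝ} (hR : 0 < R)
    (hv : ‖v‖ ≤ r) (hrR : r ≤ R / 2) :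
    |‖v - R • e‖ - R + ⟪v, e⟫| ≤ 2 * r ^ 2 / R := by
  set D := ‖v - R • e‖ with hD
  have hr0 : 0 ≤ r := (norm_nonneg v).trans hv
  have hRe : ‖R • e‖ = R := by rw [norm_smul, he, mul_one, Real.norm_eq_abs, abs_of_pos hR]
  -- `|D - R| ≤ ‖v‖`
  have hDR : |D - R| ≤ ‖v‖ := by
    have h1 := abs_norm_sub_norm_le (v - R • e) (-(R • e))
    rw [norm_neg, hRe, show v - R • e - -(R • e) = v by abel] at h1
    exact h1
  have hDpos : R / 2 ≤ D := by
    rw [abs_le] at hDR; linarith [hDR.1]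
  -- `D² = ‖v‖² − 2R⟪v,e⟫ + R²`
  have hD2 : D ^ 2 = ‖v‖ ^ 2 - 2 * R * ⟪v, e⟫ + R ^ 2 := by
    rw [hD, @norm_sub_sq_real, inner_smul_right, norm_smul, he, mul_one, Real.norm_eq_abs,
      abs_of_pos hR]
    ring
  -- the identity `(D - R + ⟪v,e⟫)(D + R) = ‖v‖² + ⟪v,e⟫ (D - R)`
  have hid : (D - R + ⟪v, e⟫) * (D + R) = ‖v‖ ^ 2 + ⟪v, e⟫ * (D - R) := by nlinarith [hD2]
  have hsum : 0 < D + R := by linarith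
  have hkey : D - R + ⟪v, e⟫ = (‖v‖ ^ 2 + ⟪v, e⟫ * (D - R)) / (D + R) := by
    rw [eq_div_iff hsum.ne']; exact hid
  rw [hkey, abs_div, abs_of_pos hsum, div_le_div_iff₀ hsum hR]
  have hinner : |⟪v, e⟫| ≤ ‖v‖ := by
    have := abs_real_inner_le_norm v e; rwa [he, mul_one] at this
  calc |‖v‖ ^ 2 + ⟪v, e⟫ * (D - R)| * R ≤ (‖v‖ ^ 2 + ‖v‖ * ‖v‖) * R := by
        refine mul_le_mul_of_nonneg_right ?_ hR.le
        calc |‖v‖ ^ 2 + ⟪v, e⟫ * (D - R)| ≤ |‖v‖ ^ 2| + |⟪v, e⟫ * (D - R)| := abs_add_le _ _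
          _ ≤ ‖v‖ ^ 2 + ‖v‖ * ‖v‖ := by
              rw [abs_of_nonneg (sq_nonneg _), abs_mul]
              exact add_le_add le_rfl (mul_le_mul hinner hDR (abs_nonneg _) (norm_nonneg _))
    _ ≤ 2 * r ^ 2 * (D + R) := by
        have hv2 : ‖v‖ * ‖v‖ ≤ r * r := mul_le_mul hv hv (norm_nonneg v) hr0
        have hD0 : 0 ≤ D := norm_nonneg _
        nlinarith [hv2, hD0, sq_nonneg r, hR.le]

/-- **The distance to a far point in a GH chart**: let `f : X → E` be an `ε`-isometry on `S`
(`|‖f x − f y‖ − d(x, y)| ≤ ε` for `x, y ∈ S`), `e` a unit vector, `R > 0`, and `q ∈ S` with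
`‖f q − R e‖ ≤ ε`. Then for `x ∈ S` with `‖f x‖ ≤ r ≤ R/2`: `|d(q, x) − R + ⟪f x, e⟫| ≤ 2ε + 2r²/R`.
[cite: CheegerColding1997, App. 1, proof of Thm. A.1.5] -/
theorem abs_dist_sub_add_inner_le_of_ghChart {X : Type*} [PseudoMetricSpace X] {S : Set X}
    {f : X → E} {ε : ℝ} (hf : ∀ x ∈ S, ∀ y ∈ S, |‖f x - f y‖ - dist x y| ≤ ε)
    {e : E} (he : ‖e‖ = 1) {R r : ℝ} (hR : 0 < R) (hrR : r ≤ R / 2) {q : X} (hq : q ∈ S)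
    (hqe : ‖f q - R • e‖ ≤ ε) {x : X} (hx : x ∈ S) (hxr : ‖f x‖ ≤ r) :
    |dist q x - R + ⟪f x, e⟫| ≤ 2 * ε + 2 * r ^ 2 / R := by
  have h1 := abs_norm_sub_smul_sub_add_inner_le he hR hxr hrR
  have h2 := hf q hq x hx
  -- `|‖f q - f x‖ - ‖R e - f x‖| ≤ ‖f q - R e‖ ≤ ε`
  have h3 : |‖f q - f x‖ - ‖f x - R • e‖| ≤ ε := by
    have := abs_norm_sub_norm_le (f q - f x) (R • e - f x)
    rw [show f q - f x - (R • e - f x) = f q - R • e by abel, norm_sub_rev (R • e) (f x)] at this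
    exact this.trans hqe
  rw [abs_le] at h1 h2 h3 ⊢
  constructor <;> linarith [h1.1, h1.2, h2.1, h2.2, h3.1, h3.2]

/-- **The normalised distance function is almost linear in the chart**: in the situation of
`abs_dist_sub_add_inner_le_of_ghChart`, for a base point `p ∈ S` with `‖f p‖ ≤ r` and every
`x ∈ S` with `‖f x‖ ≤ r`: `|(d(q, x) − d(q, p)) + ⟪f x − f p, e⟫| ≤ 4ε + 4r²/R`.
[cite: CheegerColding1997, App. 1, proof of Thm. A.1.5] -/
theorem abs_dist_sub_dist_add_inner_le_of_ghChart {X : Type*} [PseudoMetricSpace X] {S : Set X}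
    {f : X → E} {ε : ℝ} (hf : ∀ x ∈ S, ∀ y ∈ S, |‖f x - f y‖ - dist x y| ≤ ε)
    {e : E} (he : ‖e‖ = 1) {R r : ℝ} (hR : 0 < R) (hrR : r ≤ R / 2) {q : X} (hq : q ∈ S)
    (hqe : ‖f q - R • e‖ ≤ ε) {p x : X} (hp : p ∈ S) (hpr : ‖f p‖ ≤ r) (hx : x ∈ S)
    (hxr : ‖f x‖ ≤ r) :
    |(dist q x - dist q p) + ⟪f x - f p, e⟫| ≤ 4 * ε + 4 * r ^ 2 / R := by
  have h1 := abs_dist_sub_add_inner_le_of_ghChart hf he hR hrR hq hqe hx hxr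
  have h2 := abs_dist_sub_add_inner_le_of_ghChart hf he hR hrR hq hqe hp hpr
  rw [inner_sub_left, show 4 * ε + 4 * r ^ 2 / R = 2 * (2 * ε + 2 * r ^ 2 / R) by ring]
  rw [abs_le] at h1 h2 ⊢
  constructor <;> linarith [h1.1, h1.2, h2.1, h2.2]

end Literature.Geometry.Euclidean

end
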